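import Mathlib

/-!
# At density `1/2`, zero violated additive coincidences force no linear-size affine piece

A recorded negative for the additive-coincidence ("99 %-rigidity") line of this seat's toy layer
(`SoloInformedAdditiveCoincidenceRigidity`, Theorem C: on a *co-small* set `S ⊆ [1, K]`, few
violated additive coincidences of `φ` force `φ` to be affine off a sparse set).  The natural
density-`θ` analogue — called `(C_θ)` in the seat's notes — asks, for a fixed `θ ∈ (0, 1)`, for
constants `η₀, c₀ > 0` and `K₀` such that every `S ⊆ [1, K]` (`K ≥ K₀`) with `#S ≥ θ K` and every
`φ` whose violated additive coincidences on `S` (triples `((a, b), u)` with `a, b, a + u, b + u ∈ S`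
and `φ (a + u) - φ a ≠ φ (b + u) - φ b`, the vocabulary of Theorem C) fit in a set `V` with
`#V ≤ η₀ K³` admit an affine piece `φ s = γ + s μ` on some `T ⊆ S` with `#T ≥ c₀ K`.

**It is false for every `θ ≤ 1/2`** (`soloHD_not_CTheta_of_le_half`, with `φ` complex-valued as
in the notes).  Witness (`soloHD_half_density_witness`; all `m ≥ 1`, `q = N = 2m`,
`K = q N = 4 m²`): the *window set* `S = {q j + r : j < N, q - m ≤ r < q} ⊆ [1, K]` of the
naturals whose residue lies in the top window of width `m = q / 2`, with `#S = N m = K / 2`, and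
the base-`q` digit function `φ s = ⌊s / q⌋`, with `V = ∅`.
* `φ` has **no** violated additive coincidence on `S`: for `a, a + u, b, b + u ∈ S` the four
  remainders lie in a window of width `m`, so `q · ((⌊(a+u)/q⌋ - ⌊a/q⌋) - (⌊(b+u)/q⌋ - ⌊b/q⌋))`
  is a difference of two remainder-differences, of absolute value `< 2m ≤ q`, hence `0`
  (`soloHD_digit_exact`).
* every `T ⊆ [0, q N)` on which `⌊s/q⌋` agrees with an affine function `γ + s μ` (coefficients
  in any commutative ring of characteristic zero, e.g. `ℂ`) has `#T ≤ max q N` (`= 2m = √K`)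
  (`soloHD_digit_affine_piece_card_le`): with `s₀ = min T`, `s₁ = max T`, `D = s₁ - s₀`,
  `E = ⌊s₁/q⌋ - ⌊s₀/q⌋` one gets `D (r_{s₀} - r_s) = (s - s₀) δ` for all `s ∈ T`, where `r_s`
  is the remainder of `s` and `δ = q E - D`; if `δ ≠ 0` the remainder map is injective on `T`
  (`#T ≤ q`), and if `δ = 0` all of `T` lies in one residue class mod `q` (`#T ≤ N`).
So at density exactly `1/2` additive exactness is compatible with affine pieces of size `√K`
only; an affine (rank-one) conclusion needs density above `1/2` (the co-small regime of
Theorem C is `≥ 0.99`).  The mechanism is the folklore one — the residues in a window of width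
`≤ q/2` add without carry ambiguity, i.e. `S` with the digit function is Freiman-isomorphic (of
order 2) to a rank-two set [cite: TaoVu2006, §5.3 Def. 5.21 and the proof of Lemma 5.26 (the
projection is a Freiman homomorphism on each window `Z_j`); §5.5 Def. 5.40 (Freiman dimension)];
no novelty is claimed.  Role: it closes the seat's conjecture `(C_θ)` negatively on `(0, 1/2]` and
records that no "small additive energy defect at density `≤ 1/2` ⇒ linear-size affine piece"
statement exists.  No definitions are introduced (the window set is produced by an existence
lemma, `soloHD_window_exists`).
-/

namespace Summit.Schanuel.Schanuel.Theorems

open Finset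

/-! ### The digit function is additively exact on a half-width window of remainders -/

/-- **Exactness of the digit function on a window.**  If the remainders mod `q` of
`a, a + u, b, b + u` all lie in a window `[c, c + m)` with `2 m ≤ q`, then
`⌊(a+u)/q⌋ - ⌊a/q⌋ = ⌊(b+u)/q⌋ - ⌊b/q⌋` (as integers). -/
theorem soloHD_digit_exact {q m c a b u : ℕ} (hmq : 2 * m ≤ q)
    (ha₁ : c ≤ a % q) (ha₂ : a % q < c + m)
    (hau₁ : c ≤ (a + u) % q) (hau₂ : (a + u) % q < c + m)
    (hb₁ : c ≤ b % q) (hb₂ : b % q < c + m)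
    (hbu₁ : c ≤ (b + u) % q) (hbu₂ : (b + u) % q < c + m) :
    (((a + u) / q : ℕ) : ℤ) - ((a / q : ℕ) : ℤ) = (((b + u) / q : ℕ) : ℤ) - ((b / q : ℕ) : ℤ) := by
  have h1 : (q : ℤ) * ((a / q : ℕ) : ℤ) + ((a % q : ℕ) : ℤ) = (a : ℕ) := by
    exact_mod_cast Nat.div_add_mod a q
  have h2 : (q : ℤ) * (((a + u) / q : ℕ) : ℤ) + (((a + u) % q : ℕ) : ℤ) = ((a + u : ℕ) : ℤ) := by
    exact_mod_cast Nat.div_add_mod (a + u) q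
  have h3 : (q : ℤ) * ((b / q : ℕ) : ℤ) + ((b % q : ℕ) : ℤ) = (b : ℕ) := by
    exact_mod_cast Nat.div_add_mod b q
  have h4 : (q : ℤ) * (((b + u) / q : ℕ) : ℤ) + (((b + u) % q : ℕ) : ℤ) = ((b + u : ℕ) : ℤ) := by
    exact_mod_cast Nat.div_add_mod (b + u) q
  set X : ℤ := (((a + u) / q : ℕ) : ℤ) - ((a / q : ℕ) : ℤ) -
    ((((b + u) / q : ℕ) : ℤ) - ((b / q : ℕ) : ℤ)) with hX
  rw [Nat.cast_add] at h2 h4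
  -- `q * X` is a signed sum of four remainders from a window of width `m`
  have key : (q : ℤ) * X = (((a % q : ℕ) : ℤ) - (((a + u) % q : ℕ) : ℤ))
      - (((b % q : ℕ) : ℤ) - (((b + u) % q : ℕ) : ℤ)) := by
    rw [hX]; linear_combination h2 - h1 - h4 + h3
  have hlo : -(q : ℤ) < (((a % q : ℕ) : ℤ) - (((a + u) % q : ℕ) : ℤ))
      - (((b % q : ℕ) : ℤ) - (((b + u) % q : ℕ) : ℤ)) := by omega
  have hhi : (((a % q : ℕ) : ℤ) - (((a + u) % q : ℕ) : ℤ))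
      - (((b % q : ℕ) : ℤ) - (((b + u) % q : ℕ) : ℤ)) < q := by omega
  have hq : (0 : ℤ) ≤ q := by positivity
  have hX0 : X = 0 := by
    rcases lt_trichotomy X 0 with h | h | h
    · nlinarith [mul_nonneg hq (by linarith : (0 : ℤ) ≤ -X - 1)]
    · exact h
    · nlinarith [mul_nonneg hq (by linarith : (0 : ℤ) ≤ X - 1)]
  exact sub_eq_zero.mp hX0

/-- The same exactness, for the digit function with values cast into any ring. -/
theorem soloHD_digit_exact_cast {R : Type*} [Ring R] {q m c a b u : ℕ} (hmq : 2 * m ≤ q)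
    (ha₁ : c ≤ a % q) (ha₂ : a % q < c + m)
    (hau₁ : c ≤ (a + u) % q) (hau₂ : (a + u) % q < c + m)
    (hb₁ : c ≤ b % q) (hb₂ : b % q < c + m)
    (hbu₁ : c ≤ (b + u) % q) (hbu₂ : (b + u) % q < c + m) :
    (((a + u) / q : ℕ) : R) - ((a / q : ℕ) : R) = (((b + u) / q : ℕ) : R) - ((b / q : ℕ) : R) := by
  have := congrArg (Int.cast : ℤ → R)
    (soloHD_digit_exact hmq ha₁ ha₂ hau₁ hau₂ hb₁ hb₂ hbu₁ hbu₂)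
  simp only [Int.cast_sub, Int.cast_natCast] at this
  exact this

/-! ### Affine pieces of the digit function are short -/

/-- **Affine pieces of the digit function.**  Let `q ≥ 1` and let `T` be a finite set of
naturals `< q N` on which `s ↦ ⌊s/q⌋` agrees with an affine function `γ + s μ` with
coefficients in a commutative ring of characteristic zero.  Then `#T ≤ max q N`. -/
theorem soloHD_digit_affine_piece_card_le {R : Type*} [CommRing R] [CharZero R] {q N : ℕ}
    (hq : 0 < q) {T : Finset ℕ} (hT : ∀ s ∈ T, s < q * N) {γ μ : R}
    (haff : ∀ s ∈ T, ((s / q : ℕ) : R) = γ + (s : R) * μ) : T.card ≤ max q N := by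
  classical
  rcases Nat.lt_or_ge 1 T.card with hcard | hcard
  swap
  · exact hcard.trans ((Nat.one_le_of_lt hq).trans (le_max_left _ _))
  have hne : T.Nonempty := Finset.card_pos.mp (by omega)
  obtain ⟨s₀, hs₀T, hmin⟩ : ∃ s₀ ∈ T, ∀ s ∈ T, s₀ ≤ s :=
    ⟨T.min' hne, T.min'_mem hne, fun s hs => T.min'_le s hs⟩
  obtain ⟨s₁, hs₁T, hmax⟩ : ∃ s₁ ∈ T, ∀ s ∈ T, s ≤ s₁ :=
    ⟨T.max' hne, T.max'_mem hne, fun s hs => T.le_max' s hs⟩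
  have hlt : s₀ < s₁ := by
    obtain ⟨x, hx, y, hy, hxy⟩ := Finset.one_lt_card.mp hcard
    have := hmin x hx; have := hmin y hy; have := hmax x hx; have := hmax y hy
    omega
  -- Euclidean decompositions
  have hd : ∀ x : ℕ, (q : ℤ) * ((x / q : ℕ) : ℤ) + ((x % q : ℕ) : ℤ) = (x : ℕ) := fun x => by
    exact_mod_cast Nat.div_add_mod x q
  -- the cross-multiplied affine relation, an identity between integers
  have star : ∀ s ∈ T, (((s / q : ℕ) : ℤ) - ((s₀ / q : ℕ) : ℤ)) * ((s₁ : ℤ) - s₀)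
      = ((s : ℤ) - s₀) * (((s₁ / q : ℕ) : ℤ) - ((s₀ / q : ℕ) : ℤ)) := by
    intro s hs
    have e := haff s hs
    have e₀ := haff s₀ hs₀T
    have e₁ := haff s₁ hs₁T
    have key : (((((s / q : ℕ) : ℤ) - ((s₀ / q : ℕ) : ℤ)) * ((s₁ : ℤ) - s₀) : ℤ) : R)
        = ((((s : ℤ) - s₀) * (((s₁ / q : ℕ) : ℤ) - ((s₀ / q : ℕ) : ℤ)) : ℤ) : R) := by
      simp only [Int.cast_mul, Int.cast_sub, Int.cast_natCast]
      linear_combination ((s₁ : R) - s₀) * e + ((s : R) - s₁) * e₀ - ((s : R) - s₀) * e₁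
    exact Int.cast_injective key
  -- `D (r₀ - r_s) = (s - s₀) δ` with `δ = q E - D`
  have rel : ∀ s ∈ T, ((s₁ : ℤ) - s₀) * (((s₀ % q : ℕ) : ℤ) - ((s % q : ℕ) : ℤ))
      = ((s : ℤ) - s₀) * ((q : ℤ) * (((s₁ / q : ℕ) : ℤ) - ((s₀ / q : ℕ) : ℤ))
          - ((s₁ : ℤ) - s₀)) := by
    intro s hs
    have h := star s hs
    have d := hd s
    have d₀ := hd s₀
    linear_combination (q : ℤ) * h - ((s₁ : ℤ) - s₀) * d + ((s₁ : ℤ) - s₀) * d₀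
  set δ : ℤ := (q : ℤ) * (((s₁ / q : ℕ) : ℤ) - ((s₀ / q : ℕ) : ℤ)) - ((s₁ : ℤ) - s₀) with hδ
  by_cases hδ0 : δ = 0
  · -- all of `T` lies in the residue class of `s₀`
    have hr : ∀ s ∈ T, s % q = s₀ % q := by
      intro s hs
      have h := rel s hs
      rw [hδ0, mul_zero] at h
      have hD : ((s₁ : ℤ) - s₀) ≠ 0 := by omega
      have := (mul_eq_zero.mp h).resolve_left hD
      omega
    calc T.card ≤ (Finset.range N).card :=
          Finset.card_le_card_of_injOn (fun s => s / q)
            (fun s hs => Finset.mem_coe.mpr (Finset.mem_range.mpr (Nat.div_lt_of_lt_mul (hT s hs))))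
            (by
              intro x hx y hy hxy
              have hxy' : x / q = y / q := hxy
              calc x = q * (x / q) + x % q := (Nat.div_add_mod x q).symm
                _ = q * (y / q) + y % q := by rw [hxy', hr x hx, hr y hy]
                _ = y := Nat.div_add_mod y q)
      _ = N := Finset.card_range N
      _ ≤ max q N := le_max_right _ _
  · -- the remainder map is injective on `T`
    calc T.card ≤ (Finset.range q).card :=
          Finset.card_le_card_of_injOn (fun s => s % q)
            (fun s _ => Finset.mem_coe.mpr (Finset.mem_range.mpr (Nat.mod_lt s hq)))
            (by
              intro x hx y hy hxy
              have hxy' : x % q = y % q := hxy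
              have hx' := rel x hx
              have hy' := rel y hy
              rw [hxy'] at hx'
              have hxyδ : ((x : ℤ) - s₀) * δ = ((y : ℤ) - s₀) * δ := hx'.symm.trans hy'
              have := mul_right_cancel₀ hδ0 hxyδ
              omega)
      _ = q := Finset.card_range q
      _ ≤ max q N := le_max_left _ _

/-! ### The window set -/

/-- **The window set.**  For `1 ≤ m`, `2 m ≤ q` and any `N` there is a set `S ⊆ [1, q N]` with
exactly `N m` elements, all `< q N` and all with remainder mod `q` in the top window
`[q - m, q)` — namely `{q j + r : j < N, q - m ≤ r < q}`. -/
theorem soloHD_window_exists {q m : ℕ} (N : ℕ) (hm : 1 ≤ m) (hmq : 2 * m ≤ q) :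
    ∃ S : Finset ℕ, S ⊆ Finset.Icc 1 (q * N) ∧ S.card = N * m ∧
      ∀ s ∈ S, s < q * N ∧ q - m ≤ s % q := by
  classical
  have hq : 0 < q := by omega
  refine ⟨((Finset.range N) ×ˢ (Finset.Ico (q - m) q)).image (fun p => q * p.1 + p.2), ?_, ?_, ?_⟩
  · -- `S ⊆ [1, q N]`
    intro s hs
    obtain ⟨⟨j, r⟩, hp, rfl⟩ := Finset.mem_image.mp hs
    rw [Finset.mem_product, Finset.mem_range, Finset.mem_Ico] at hp
    rw [Finset.mem_Icc]
    refine ⟨by omega, ?_⟩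
    calc q * j + r ≤ q * j + q := by omega
      _ = q * (j + 1) := by ring
      _ ≤ q * N := Nat.mul_le_mul_left q hp.1
  · -- `#S = N m`
    rw [Finset.card_image_of_injOn, Finset.card_product, Finset.card_range, Nat.card_Ico]
    · congr 1; omega
    · rintro ⟨j, r⟩ hp ⟨j', r'⟩ hp' h
      simp only [Finset.coe_product, Set.mem_prod, Finset.mem_coe, Finset.mem_range,
        Finset.mem_Ico] at hp hp'
      have h' : q * j + r = q * j' + r' := h
      have hj : j = j' := by
        have := congrArg (· / q) h'
        simpa [Nat.mul_add_div hq, Nat.div_eq_of_lt hp.2.2, Nat.div_eq_of_lt hp'.2.2] using this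
      subst hj
      have hr : r = r' := by omega
      subst hr
      rfl
  · -- quotient `< N`, remainder in the window
    intro s hs
    obtain ⟨⟨j, r⟩, hp, rfl⟩ := Finset.mem_image.mp hs
    rw [Finset.mem_product, Finset.mem_range, Finset.mem_Ico] at hp
    dsimp only
    constructor
    · calc q * j + r < q * j + q := by omega
        _ = q * (j + 1) := by ring
        _ ≤ q * N := Nat.mul_le_mul_left q hp.1
    · rw [Nat.mul_add_mod, Nat.mod_eq_of_lt hp.2.2]
      exact hp.2.1

/-! ### The witness and the refutation of `(C_θ)` for `θ ≤ 1/2` -/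

/-- **The explicit witness at density `1/2`.**  For every `m ≥ 1` (`K = 4 m²`) there is
`S ⊆ [1, K]` with `#S = 2 m² = K / 2` such that the digit function `s ↦ ⌊s / (2m)⌋`, with values
in any commutative ring `R` of characteristic zero, has **no** violated additive coincidence on `S`
(`a, a + u, b, b + u ∈ S ⇒ ⌊(a+u)/2m⌋ - ⌊a/2m⌋ = ⌊(b+u)/2m⌋ - ⌊b/2m⌋`), while every `T ⊆ S` on
which it is affine (`= γ + s μ`) has `#T ≤ 2 m`. -/
theorem soloHD_half_density_witness (R : Type*) [CommRing R] [CharZero R] {m : ℕ} (hm : 1 ≤ m) :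
    ∃ S : Finset ℕ, S ⊆ Finset.Icc 1 (2 * m * (2 * m)) ∧ S.card = 2 * m * m ∧
      (∀ a b u : ℕ, a ∈ S → a + u ∈ S → b ∈ S → b + u ∈ S →
        (((a + u) / (2 * m) : ℕ) : R) - ((a / (2 * m) : ℕ) : R)
          = (((b + u) / (2 * m) : ℕ) : R) - ((b / (2 * m) : ℕ) : R)) ∧
      ∀ T : Finset ℕ, T ⊆ S → ∀ γ μ : R,
        (∀ s ∈ T, ((s / (2 * m) : ℕ) : R) = γ + (s : R) * μ) → T.card ≤ 2 * m := by
  obtain ⟨S, hSub, hCard, hS⟩ := soloHD_window_exists (q := 2 * m) (m := m) (2 * m) hm le_rfl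
  refine ⟨S, hSub, hCard, ?_, ?_⟩
  · intro a b u ha hau hb hbu
    have hq : 0 < 2 * m := by omega
    exact soloHD_digit_exact_cast (c := 2 * m - m) (m := m) le_rfl
      (hS a ha).2 (by have := Nat.mod_lt a hq; omega)
      (hS _ hau).2 (by have := Nat.mod_lt (a + u) hq; omega)
      (hS b hb).2 (by have := Nat.mod_lt b hq; omega)
      (hS _ hbu).2 (by have := Nat.mod_lt (b + u) hq; omega)
  · intro T hT γ μ haff
    have h := soloHD_digit_affine_piece_card_le (R := R) (q := 2 * m) (N := 2 * m) (by omega)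
      (fun s hs => (hS s (hT hs)).1) haff
    simpa using h

/-- **`(C_θ)` is false for every `θ ≤ 1/2`** (stated in the vocabulary of Theorem C, with the
violated additive coincidences collected in a finite set `V` of triples `((a, b), u)` and
complex-valued `φ`): there are no `η₀, c₀ > 0`, `K₀` such that every `S ⊆ [1, K]`, `K ≥ K₀`,
`#S ≥ θ K`, and every `φ : ℕ → ℂ` whose violated coincidences on `S` fit in a set of size
`≤ η₀ K³` admit `T ⊆ S`, `#T ≥ c₀ K`, on which `φ` is affine. -/
theorem soloHD_not_CTheta_of_le_half {θ : ℝ} (hθ : θ ≤ 1 / 2) :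
    ¬ ∃ η₀ : ℝ, 0 < η₀ ∧ ∃ c₀ : ℝ, 0 < c₀ ∧ ∃ K₀ : ℕ, ∀ K : ℕ, K₀ ≤ K →
      ∀ S : Finset ℕ, S ⊆ Finset.Icc 1 K → θ * K ≤ (S.card : ℝ) →
        ∀ φ : ℕ → ℂ, ∀ V : Finset ((ℕ × ℕ) × ℕ),
          (∀ a ∈ S, ∀ b ∈ S, ∀ u : ℕ, a + u ∈ S → b + u ∈ S →
            φ (a + u) - φ a ≠ φ (b + u) - φ b → ((a, b), u) ∈ V) →
          (V.card : ℝ) ≤ η₀ * (K : ℝ) ^ 3 →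
            ∃ T : Finset ℕ, T ⊆ S ∧ c₀ * K ≤ (T.card : ℝ) ∧
              ∃ γ μ : ℂ, ∀ s ∈ T, φ s = γ + (s : ℂ) * μ := by
  rintro ⟨η₀, hη₀, c₀, hc₀, K₀, h⟩
  -- the scale `m`: `m ≥ K₀` and `c₀ m > 1`
  obtain ⟨m, hmK₀, hmc⟩ : ∃ m : ℕ, K₀ ≤ m ∧ 1 / c₀ + 1 ≤ (m : ℝ) := by
    refine ⟨max K₀ (⌈1 / c₀⌉₊ + 1), le_max_left _ _, ?_⟩
    calc (1 / c₀ + 1 : ℝ) ≤ (⌈1 / c₀⌉₊ : ℝ) + 1 := by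
          have := Nat.le_ceil (1 / c₀); linarith
      _ = ((⌈1 / c₀⌉₊ + 1 : ℕ) : ℝ) := by push_cast; ring
      _ ≤ ((max K₀ (⌈1 / c₀⌉₊ + 1) : ℕ) : ℝ) := by exact_mod_cast le_max_right _ _
  have hc₀' : 0 < 1 / c₀ := one_div_pos.mpr hc₀
  have hm1r : (1 : ℝ) ≤ m := by linarith
  have hm1 : 1 ≤ m := by exact_mod_cast hm1r
  have hcm : 1 < c₀ * m := by
    have h1 : c₀ * (1 / c₀ + 1) ≤ c₀ * m := by gcongr
    have h2 : c₀ * (1 / c₀ + 1) = 1 + c₀ := by field_simp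
    linarith
  obtain ⟨S, hSub, hCard, hExact, hPiece⟩ := soloHD_half_density_witness ℂ hm1
  have hK₀ : K₀ ≤ 2 * m * (2 * m) := hmK₀.trans (by nlinarith [hm1])
  have hdens : θ * ((2 * m * (2 * m) : ℕ) : ℝ) ≤ (S.card : ℝ) := by
    rw [hCard]; push_cast; nlinarith [mul_nonneg (sub_nonneg.mpr hθ) (sq_nonneg (m : ℝ))]
  have hV : ∀ a ∈ S, ∀ b ∈ S, ∀ u : ℕ, a + u ∈ S → b + u ∈ S →
      (((a + u) / (2 * m) : ℕ) : ℂ) - ((a / (2 * m) : ℕ) : ℂ)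
        ≠ (((b + u) / (2 * m) : ℕ) : ℂ) - ((b / (2 * m) : ℕ) : ℂ) →
      ((a, b), u) ∈ (∅ : Finset ((ℕ × ℕ) × ℕ)) :=
    fun a ha b hb u hau hbu hne => absurd (hExact a b u ha hau hb hbu) hne
  have hVcard : (((∅ : Finset ((ℕ × ℕ) × ℕ)).card : ℕ) : ℝ) ≤ η₀ * (((2 * m * (2 * m) : ℕ) : ℝ)) ^ 3 := by
    rw [Finset.card_empty]; push_cast; positivity
  obtain ⟨T, hTS, hTcard, γ, μ, haff⟩ :=
    h (2 * m * (2 * m)) hK₀ S hSub hdens (fun s => ((s / (2 * m) : ℕ) : ℂ)) ∅ hV hVcard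
  have hTle : (T.card : ℝ) ≤ 2 * m := by exact_mod_cast hPiece T hTS γ μ haff
  have hm0 : (0 : ℝ) < m := by linarith
  push_cast at hTcard
  -- `c₀ · 4 m² = 4 m (c₀ m) > 4 m ≥ 2 m ≥ #T`, contradiction
  nlinarith [mul_lt_mul_of_pos_left hcm hm0, hTle, hTcard, hm1r]

end Summit.Schanuel.Schanuel.Theorems
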